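import Summits.QuantumFields.YangMills.Theorems.SwapVirialDeficitBlowUpGnomonicDefs
import Summits.QuantumFields.YangMills.Theorems.SwapVirialDeficitBlowUpRingChart
import Summits.QuantumFields.YangMills.Theorems.SwapVirialDeficitQuantitativeLaplaceMeasurableCurry
import Summits.QuantumFields.YangMills.Theorems.SwapVirialDeficitQuantitativeLaplaceChartRestrict
import Literature.Analysis.Asymptotics.LaplaceMethodChartComposition
import Mathlib.MeasureTheory.Measure.Haar.InnerProductSpace
import HarnessLib

/-!
# W3-pack, part 1: THE EUCLIDEAN FIBRE of the gnomonic chart — the fibre∕base split of `GnoCoord L` as a volume-preserving linear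
# measurable equivalence `(ℝ × ℝ) × V_L ≃ GnoCoord L`, `V_L = EuclideanSpace ℝ ((Fin 2 ⊕ Fin 2) ⊕ (Fin 3 ⊕ Fol L × Fin 3))`
# (free-hands support of ⟨stmt-QuantumFields-24197⟩ `SwapVirialDeficit.SwapGluedStiffness`; the `V`, `Ψ`, `hchart` letters of
# ✓`QuantitativeLaplace.laplaceMethod_quantitative_fibred_chart_cubic_offBound` for the bulk of LEAD ym-line-sfw-p2 g97's steep-window Morse–Bott plan)

The Euler dilation ✓`eulerDilate` of the gnomonic coordinates `η = ((x, y), (z, η_F)) : GnoCoord L` fixes the axial components `x₀, y₀` of the two free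
leader letters and dilates everything else: the FIBRE is `(x_⊥, y_⊥, z, η_F)` (`2 + 2 + 3 + 3|Fol L| = 18L⁴ − 2 = 2α` real dimensions), the BASE (besides the hub and
the hemisphere signs, which are outer parameters of the chart ✓`integral_ringMeasure_eq_gnomonic`) is `(x₀, y₀) ∈ ℝ × ℝ`.  The generic fibred Laplace cores of
ns `…QuantitativeLaplace` want the fibre as a finite-dimensional real INNER-PRODUCT space `V` with its Lebesgue (`volume`) measure; w3 g65's model-side coercivity
✓`fibre_raySecond_coercive_gnomonic` is stated on the parameter block `W = (ℝ² × ℝ²) × ℝ³ × (ℝ³)^{Fol L}` with the gauge `N(w) = |u|² + |v|² + |z|² + Σ_f|η_f|²`.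
This file fixes `V` once and for all and proves that nothing is lost in translation:

* §1 `GnoFibreIdx L`, `GnoFibre L := EuclideanSpace ℝ (GnoFibreIdx L)`; `gnoBase x₀ y₀ : GnoCoord L` (w3's base point `((x₀e₀, y₀e₀), 0, 0)`, syntactically);
  `gnoFibreBlocks : GnoFibre L → W` (the four letter blocks), `gnoFibreLin : (ℝ × ℝ) × GnoFibre L ≃ₗ[ℝ] GnoCoord L`, `((x₀,y₀), y) ↦ gnoBase x₀ y₀ + ξ(blocks y)`,
  its continuous version `gnoFibreCLE` and the measurable equivalence `gnoFibreEquiv`; the fibre embedding `gnoFibreEmb : GnoFibre L →L[ℝ] GnoCoord L`.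
* §2 API: `gnoFibreEquiv_apply` (`= gnoBase + gnoFibreEmb`), `gnoFibreEmb_eq_fibreDir` (`gnoFibreEmb y` IS w3's direction `ξ(gnoFibreBlocks y)`, by `rfl`),
  ★ `norm_sq_gnoFibre` (`‖y‖² = N(gnoFibreBlocks y)` verbatim), `letterSizes_gnoFibreEmb_le` (every letter of `gnoFibreEmb y` has Euclidean size `≤ ‖y‖` — the `S` of
  ✓`taylor_four_gnoDeficit_line`), `finrank_gnoFibre` (`= 18L⁴ − 2`) and `finrank_gnoFibre_real_div_two` (`= 9L⁴ − 1` — the exponent `e₀ L` of ✓`swapGluedStiffness_of_bulk_rest`);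
  the CYLINDER ∕ TUBE over a base set `S`: `gnoFibreEquiv_image_prod_univ` (`= {(η_x 0, η_y 0) ∈ S}`), `gnoFibreEquiv_image_prod_closedBall`, `exists_of_mem_cylinder_not_mem_tube`
  (in the cylinder but off the tube ⟹ `η = gnoBase x₀ y₀ + gnoFibreEmb y` with `R < ‖y‖`, the input format of ✓`offTube_bound_of_cylinder`), `measurableSet_cylinder`.
* §3 ★★ `volume_preserving_gnoFibreEquiv` — `vol_{ℝ×ℝ} ⊗ vol_V ↦ vol_{GnoCoord L}` (✓`PiLp.volume_preserving_ofLp`, ✓`volume_measurePreserving_sumPiEquivProdPi`,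
  w2 g58's ✓`volume_preserving_curry`, ✓`volume_preserving_piFinSuccAbove`); ★ `volume_gnoCoord_eq_map` — the GLOBAL chart identity
  `vol.withDensity ρ = (gnoFibreEquiv)_*((vol ⊗ vol).withDensity (ρ ∘ gnoFibreEquiv))` for any measurable `ρ ≥ 0` (e.g. `gnoDensity`), i.e. the `hμ` of
  ✓`QuantitativeLaplace.restrict_image_eq_map_of_measurableEquiv`; ★ `volume_withDensity_restrict_cylinder_eq_map` — the same for the BULK-CYLINDER measure
  `(vol·ρ)|_{gnoFibreEquiv(S × V_L)}` with base measure `vol|_S` (the `ν` of the bulk law is the restricted Lebesgue measure of the bulk base square).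

What is NOT here: the Hessian operators ∕ coercivity ∕ cubic datum on `V` (part 2, `…BlowUpGnomonicFibreHessianPackage`), anything about the tip or sector `001`.
HONEST LABEL: definitions and linear∕measure-theoretic bookkeeping only; ⟨24197⟩ ∕ ⟨24194⟩ (window-uniform) OPEN; own crux ⟨22884⟩ OPEN (blocked-on ⟨19935⟩); no crux, rung
of record or summit is proved; the Yang–Mills mass gap is NOT proved; no summit is proved by a line.  Width seat ym-line-sfw-p2-w2 g59 (cell ym-idea-1, free hands),
`--supports stmt-QuantumFields-24197`.  Definitions + theorems, 0 `sorry`, standard axioms.  References: [folklore].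
-/

set_option autoImplicit false
set_option synthInstance.maxSize 1024

noncomputable section

open MeasureTheory Set
open scoped BigOperators ENNReal

namespace Summit.QuantumFields.YangMills.Theorems.SwapVirialDeficit.BlowUpRing

open Summit.QuantumFields.YangMills.Theorems.FemtoTransferGap
open Summit.QuantumFields.YangMills.Theorems.SwapVirialDeficit.Gnomonic (normSq3)

variable {L : ℕ} [NeZero L]

/-! ## §1 The Euclidean fibre, the base point, the linear chart -/

variable (L) in
/-- INDEX SET OF THE FIBRE LETTERS: `(x_⊥ : Fin 2) ⊕ (y_⊥ : Fin 2)`, then `(z : Fin 3) ⊕ (followers : Fol L × Fin 3)`. [folklore] -/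
abbrev GnoFibreIdx : Type := (Fin 2 ⊕ Fin 2) ⊕ (Fin 3 ⊕ Fol L × Fin 3)

variable (L) in
/-- THE EUCLIDEAN FIBRE `V_L` of the gnomonic chart: `ℝ^{(Fin 2 ⊕ Fin 2) ⊕ (Fin 3 ⊕ Fol L × Fin 3)}` with its `ℓ²` inner product (`2α = 18L⁴ − 2` dimensions). [folklore] -/
abbrev GnoFibre : Type := EuclideanSpace ℝ (GnoFibreIdx L)

/-- THE BASE POINT over `(x₀, y₀)`: `((x₀e₀, y₀e₀), 0, 0)` — axial free leader letters, trivial `z`-letter and followers (w3 g65's `η₀`, syntactically). [folklore] -/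
def gnoBase (x₀ y₀ : ℝ) : GnoCoord L :=
  (((![x₀, 0, 0] : Fin 3 → ℝ), (![y₀, 0, 0] : Fin 3 → ℝ)), ((0 : Fin 3 → ℝ), (0 : Fol L → Fin 3 → ℝ)))

/-- THE FOUR LETTER BLOCKS `w(y) = ((u, v), z, η_F)` of a fibre vector (w3 g65's parameter block `W`). [folklore] -/
def gnoFibreBlocks (y : GnoFibre L) : ((Fin 2 → ℝ) × (Fin 2 → ℝ)) × (Fin 3 → ℝ) × (Fol L → Fin 3 → ℝ) :=
  (((fun j => y (Sum.inl (Sum.inl j))), (fun j => y (Sum.inl (Sum.inr j)))), ((fun k => y (Sum.inr (Sum.inl k))), (fun f k => y (Sum.inr (Sum.inr (f, k))))))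

/-- The inverse reading: the fibre vector of a gnomonic coordinate (drop `x₀, y₀`). [folklore] -/
def gnoFibreOf (η : GnoCoord L) : GnoFibre L :=
  WithLp.toLp 2 (Sum.elim (Sum.elim (fun j : Fin 2 => η.1.1 j.succ) (fun j : Fin 2 => η.1.2 j.succ))
    (Sum.elim (fun k : Fin 3 => η.2.1 k) (fun fk : Fol L × Fin 3 => η.2.2 fk.1 fk.2)))

/-- THE LINEAR FIBRE∕BASE CHART `((x₀, y₀), y) ↦ ((x₀, u), (y₀, v), z, η_F)` as a linear equivalence `(ℝ × ℝ) × V_L ≃ₗ GnoCoord L`. [folklore] -/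
def gnoFibreLin : ((ℝ × ℝ) × GnoFibre L) ≃ₗ[ℝ] GnoCoord L where
  toFun q := (((![q.1.1, q.2 (Sum.inl (Sum.inl 0)), q.2 (Sum.inl (Sum.inl 1))] : Fin 3 → ℝ),
      (![q.1.2, q.2 (Sum.inl (Sum.inr 0)), q.2 (Sum.inl (Sum.inr 1))] : Fin 3 → ℝ)),
    ((fun k => q.2 (Sum.inr (Sum.inl k))), (fun f k => q.2 (Sum.inr (Sum.inr (f, k))))))
  invFun η := ((η.1.1 0, η.1.2 0), gnoFibreOf η)
  map_add' q q' := by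
    refine Prod.ext (Prod.ext ?_ ?_) (Prod.ext ?_ ?_)
    · funext k; fin_cases k <;> simp
    · funext k; fin_cases k <;> simp
    · funext k; simp
    · funext f k; simp
  map_smul' c q := by
    refine Prod.ext (Prod.ext ?_ ?_) (Prod.ext ?_ ?_)
    · funext k; fin_cases k <;> simp
    · funext k; fin_cases k <;> simp
    · funext k; simp
    · funext f k; simp
  left_inv q := by
    obtain ⟨⟨x₀, y₀⟩, y⟩ := q
    refine Prod.ext (Prod.ext rfl rfl) ?_
    refine PiLp.ext fun i => ?_
    rcases i with ((j | j) | (k | ⟨f, k⟩))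
    · fin_cases j <;> rfl
    · fin_cases j <;> rfl
    · rfl
    · rfl
  right_inv η := by
    obtain ⟨⟨x, y⟩, z, F⟩ := η
    refine Prod.ext (Prod.ext ?_ ?_) (Prod.ext ?_ ?_)
    · funext k; fin_cases k <;> rfl
    · funext k; fin_cases k <;> rfl
    · rfl
    · rfl

/-- The same chart as a CONTINUOUS linear equivalence (finite dimensions). [folklore] -/
def gnoFibreCLE : ((ℝ × ℝ) × GnoFibre L) ≃L[ℝ] GnoCoord L :=
  (gnoFibreLin (L := L)).toContinuousLinearEquiv

/-- ★ THE FIBRE∕BASE SPLIT OF `GnoCoord L` AS A MEASURABLE EQUIVALENCE `(ℝ × ℝ) × V_L ≃ᵐ GnoCoord L`. [folklore] -/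
def gnoFibreEquiv : ((ℝ × ℝ) × GnoFibre L) ≃ᵐ GnoCoord L :=
  (gnoFibreCLE (L := L)).toHomeomorph.toMeasurableEquiv

/-- THE FIBRE EMBEDDING `y ↦ ((0, u), (0, v), z, η_F)` as a continuous linear map `V_L →L GnoCoord L` (w3 g65's direction `ξ(w(y))`). [folklore] -/
def gnoFibreEmb : GnoFibre L →L[ℝ] GnoCoord L :=
  (gnoFibreCLE (L := L)).toContinuousLinearMap.comp (ContinuousLinearMap.inr ℝ (ℝ × ℝ) (GnoFibre L))

/-! ## §2 API: formulas, the gauge identity, letter sizes, the dimension -/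

/-- The chart, pointwise. [folklore] -/
theorem gnoFibreEquiv_apply' (q : (ℝ × ℝ) × GnoFibre L) :
    gnoFibreEquiv q = (((![q.1.1, q.2 (Sum.inl (Sum.inl 0)), q.2 (Sum.inl (Sum.inl 1))] : Fin 3 → ℝ),
      (![q.1.2, q.2 (Sum.inl (Sum.inr 0)), q.2 (Sum.inl (Sum.inr 1))] : Fin 3 → ℝ)),
      ((fun k => q.2 (Sum.inr (Sum.inl k))), (fun f k => q.2 (Sum.inr (Sum.inr (f, k)))))) := rfl

/-- The measurable chart and the continuous linear chart are the same map. [folklore] -/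
theorem gnoFibreEquiv_apply_eq_CLE (q : (ℝ × ℝ) × GnoFibre L) : gnoFibreEquiv q = gnoFibreCLE q := rfl

/-- The inverse chart, pointwise: base `(x₀, y₀) = (η_x 0, η_y 0)`, fibre `gnoFibreOf η`. [folklore] -/
theorem gnoFibreEquiv_symm_apply (η : GnoCoord L) : (gnoFibreEquiv (L := L)).symm η = ((η.1.1 0, η.1.2 0), gnoFibreOf η) := rfl

/-- The fibre embedding, pointwise. [folklore] -/
theorem gnoFibreEmb_apply (y : GnoFibre L) :
    gnoFibreEmb y = (((![0, y (Sum.inl (Sum.inl 0)), y (Sum.inl (Sum.inl 1))] : Fin 3 → ℝ), (![0, y (Sum.inl (Sum.inr 0)), y (Sum.inl (Sum.inr 1))] : Fin 3 → ℝ)),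
      ((fun k => y (Sum.inr (Sum.inl k))), (fun f k => y (Sum.inr (Sum.inr (f, k)))))) := rfl

/-- ★ `gnoFibreEmb y` IS w3 g65's fibre direction `ξ(w)` at `w = gnoFibreBlocks y` — by `rfl`, so ✓`fibre_raySecond_coercive_gnomonic` ∕ ✓`fibre_growth_gnomonic` ∕
✓`fibre_far_floor_gnomonic` apply verbatim with `w := gnoFibreBlocks y`. [folklore] -/
theorem gnoFibreEmb_eq_fibreDir (y : GnoFibre L) :
    gnoFibreEmb y = ((((![0, (gnoFibreBlocks y).1.1 0, (gnoFibreBlocks y).1.1 1] : Fin 3 → ℝ), (![0, (gnoFibreBlocks y).1.2 0, (gnoFibreBlocks y).1.2 1] : Fin 3 → ℝ)),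
      ((gnoFibreBlocks y).2.1, (gnoFibreBlocks y).2.2)) : GnoCoord L) := rfl

/-- ★ The chart is `base point + fibre direction`: `gnoFibreEquiv ((x₀,y₀), y) = gnoBase x₀ y₀ + gnoFibreEmb y`. [folklore] -/
theorem gnoFibreEquiv_apply (p : ℝ × ℝ) (y : GnoFibre L) : gnoFibreEquiv (p, y) = gnoBase p.1 p.2 + gnoFibreEmb y := by
  rw [gnoFibreEquiv_apply', gnoFibreEmb_apply, gnoBase]
  refine Prod.ext (Prod.ext ?_ ?_) (Prod.ext ?_ ?_)
  · funext k; fin_cases k <;> simp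
  · funext k; fin_cases k <;> simp
  · funext k; simp
  · funext f k; simp

/-- The chart along a ray: `gnoFibreEquiv ((x₀,y₀), s • y) = gnoBase x₀ y₀ + s • gnoFibreEmb y`. [folklore] -/
theorem gnoFibreEquiv_apply_smul (p : ℝ × ℝ) (s : ℝ) (y : GnoFibre L) : gnoFibreEquiv (p, s • y) = gnoBase p.1 p.2 + s • gnoFibreEmb y := by
  rw [gnoFibreEquiv_apply, map_smul]

/-- ★ **THE GAUGE IDENTITY**: `‖y‖² = |u|² + |v|² + |z|² + Σ_f |η_f|²` with `((u,v),z,η_F) = gnoFibreBlocks y` — the Euclidean norm of `V_L` IS w3 g65's fibre gauge `N(w)`,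
in the letters of ✓`fibre_raySecond_coercive_gnomonic`. [folklore] -/
theorem norm_sq_gnoFibre (y : GnoFibre L) :
    ‖y‖ ^ 2 = (gnoFibreBlocks y).1.1 0 ^ 2 + (gnoFibreBlocks y).1.1 1 ^ 2 + ((gnoFibreBlocks y).1.2 0 ^ 2 + (gnoFibreBlocks y).1.2 1 ^ 2) +
      normSq3 (gnoFibreBlocks y).2.1 + ∑ f, normSq3 ((gnoFibreBlocks y).2.2 f) := by
  rw [EuclideanSpace.real_norm_sq_eq, Fintype.sum_sum_type, Fintype.sum_sum_type, Fintype.sum_sum_type, Fintype.sum_prod_type, Fin.sum_univ_two,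
    Fin.sum_univ_two]
  simp only [gnoFibreBlocks, normSq3]
  ring

/-- The gauge is at most `‖y‖²` blockwise: each letter of `gnoFibreEmb y` has squared Euclidean size `≤ ‖y‖²`. [folklore] -/
theorem letterSq_gnoFibreEmb_le (y : GnoFibre L) :
    (∑ k, (gnoFibreEmb y).1.1 k ^ 2 ≤ ‖y‖ ^ 2) ∧ (∑ k, (gnoFibreEmb y).1.2 k ^ 2 ≤ ‖y‖ ^ 2) ∧ (∑ k, (gnoFibreEmb y).2.1 k ^ 2 ≤ ‖y‖ ^ 2) ∧
      ∀ i, ∑ k, (gnoFibreEmb y).2.2 i k ^ 2 ≤ ‖y‖ ^ 2 := by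
  have hN := norm_sq_gnoFibre y
  have h0 : 0 ≤ (gnoFibreBlocks y).1.1 0 ^ 2 + (gnoFibreBlocks y).1.1 1 ^ 2 := by positivity
  have h1 : 0 ≤ (gnoFibreBlocks y).1.2 0 ^ 2 + (gnoFibreBlocks y).1.2 1 ^ 2 := by positivity
  have h2 : 0 ≤ normSq3 (gnoFibreBlocks y).2.1 := Finset.sum_nonneg fun k _ => sq_nonneg _
  have h3 : 0 ≤ ∑ f, normSq3 ((gnoFibreBlocks y).2.2 f) := Finset.sum_nonneg fun f _ => Finset.sum_nonneg fun k _ => sq_nonneg _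
  have ex : ∑ k, (gnoFibreEmb y).1.1 k ^ 2 = (gnoFibreBlocks y).1.1 0 ^ 2 + (gnoFibreBlocks y).1.1 1 ^ 2 := by
    simp only [gnoFibreEmb_apply, gnoFibreBlocks, Fin.sum_univ_three, Matrix.cons_val_zero, Matrix.cons_val_one, Matrix.cons_val_two,
      Matrix.tail_cons, Matrix.head_cons]; ring
  have ey : ∑ k, (gnoFibreEmb y).1.2 k ^ 2 = (gnoFibreBlocks y).1.2 0 ^ 2 + (gnoFibreBlocks y).1.2 1 ^ 2 := by
    simp only [gnoFibreEmb_apply, gnoFibreBlocks, Fin.sum_univ_three, Matrix.cons_val_zero, Matrix.cons_val_one, Matrix.cons_val_two,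
      Matrix.tail_cons, Matrix.head_cons]; ring
  have ez : ∑ k, (gnoFibreEmb y).2.1 k ^ 2 = normSq3 (gnoFibreBlocks y).2.1 := rfl
  have ef : ∀ i, ∑ k, (gnoFibreEmb y).2.2 i k ^ 2 = normSq3 ((gnoFibreBlocks y).2.2 i) := fun i => rfl
  refine ⟨?_, ?_, ?_, fun i => ?_⟩
  · rw [ex]; linarith
  · rw [ey]; linarith
  · rw [ez]; linarith
  · rw [ef i]
    have : normSq3 ((gnoFibreBlocks y).2.2 i) ≤ ∑ f, normSq3 ((gnoFibreBlocks y).2.2 f) :=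
      Finset.single_le_sum (f := fun f => normSq3 ((gnoFibreBlocks y).2.2 f)) (fun f _ => Gnomonic.normSq3_nonneg _) (Finset.mem_univ i)
    linarith

/-- ★ **LETTER SIZES**: every letter of `gnoFibreEmb y` has Euclidean size `≤ ‖y‖` — the hypotheses `hx hy hz hf` of fcl-p3 g47's ✓`taylor_four_gnoDeficit_line` with
`S := ‖y‖` (sharper than the ambient sup-norm reading ✓`taylor_four_gnoDeficit_line_norm`, no `√3`). [folklore] -/
theorem letterSizes_gnoFibreEmb_le (y : GnoFibre L) :
    Real.sqrt (∑ k, (gnoFibreEmb y).1.1 k ^ 2) ≤ ‖y‖ ∧ Real.sqrt (∑ k, (gnoFibreEmb y).1.2 k ^ 2) ≤ ‖y‖ ∧ Real.sqrt (∑ k, (gnoFibreEmb y).2.1 k ^ 2) ≤ ‖y‖ ∧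
      ∀ i, Real.sqrt (∑ k, (gnoFibreEmb y).2.2 i k ^ 2) ≤ ‖y‖ := by
  obtain ⟨hx, hy, hz, hf⟩ := letterSq_gnoFibreEmb_le y
  have hn : 0 ≤ ‖y‖ := norm_nonneg _
  exact ⟨(Real.sqrt_le_sqrt hx).trans_eq (Real.sqrt_sq hn), (Real.sqrt_le_sqrt hy).trans_eq (Real.sqrt_sq hn),
    (Real.sqrt_le_sqrt hz).trans_eq (Real.sqrt_sq hn), fun i => (Real.sqrt_le_sqrt (hf i)).trans_eq (Real.sqrt_sq hn)⟩

/-- The index set has `4 + 3 + 3|Fol L|` elements. [folklore] -/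
theorem card_gnoFibreIdx : Fintype.card (GnoFibreIdx L) = 7 + 3 * Fintype.card (Fol L) := by
  simp only [GnoFibreIdx, Fintype.card_sum, Fintype.card_fin, Fintype.card_prod]; ring

/-- ★ **THE FIBRE DIMENSION** `dim V_L = 18L⁴ − 2 = 2α` (✓`card_fol`: `|Fol L| = 6L⁴ − 3`). [folklore] -/
theorem finrank_gnoFibre : Module.finrank ℝ (GnoFibre L) = 18 * L ^ 4 - 2 := by
  rw [finrank_euclideanSpace, card_gnoFibreIdx, card_fol]
  have h1 : 1 ≤ L ^ 4 := Nat.one_le_pow _ _ (Nat.pos_of_ne_zero (NeZero.ne L))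
  omega

/-- The fibre dimension as a real number: `(dim V_L : ℝ) = 18L⁴ − 2`. [folklore] -/
theorem finrank_gnoFibre_real : (Module.finrank ℝ (GnoFibre L) : ℝ) = 18 * (L : ℝ) ^ 4 - 2 := by
  rw [finrank_gnoFibre]
  have h1 : 1 ≤ L ^ 4 := Nat.one_le_pow _ _ (Nat.pos_of_ne_zero (NeZero.ne L))
  have h2 : 2 ≤ 18 * L ^ 4 := by omega
  rw [Nat.cast_sub h2]; push_cast; ring

/-- ★ Half the fibre dimension is the principal exponent `α = 9L⁴ − 1` (the `e₀ L` of ✓`SwapRing.swapGluedStiffness_of_bulk_rest`). [folklore] -/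
theorem finrank_gnoFibre_real_div_two : (Module.finrank ℝ (GnoFibre L) : ℝ) / 2 = 9 * (L : ℝ) ^ 4 - 1 := by
  rw [finrank_gnoFibre_real]; ring

/-- The base point is continuous (indeed linear) in `(x₀, y₀)`. [folklore] -/
theorem continuous_gnoBase : Continuous fun p : ℝ × ℝ => (gnoBase p.1 p.2 : GnoCoord L) := by
  have h : ∀ p : ℝ × ℝ, gnoFibreCLE (p, (0 : GnoFibre L)) = (gnoBase p.1 p.2 : GnoCoord L) := fun p => by
    rw [← gnoFibreEquiv_apply_eq_CLE, gnoFibreEquiv_apply, map_zero, add_zero]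
  exact ((gnoFibreCLE (L := L)).continuous.comp (continuous_id.prodMk continuous_const)).congr h

/-- The chart is measurable (and so is its inverse: it is a `MeasurableEquiv`). [folklore] -/
theorem measurable_gnoFibreEquiv : Measurable (gnoFibreEquiv (L := L)) := (gnoFibreEquiv (L := L)).measurable

/-- ★ **THE CYLINDER over a base set**: `gnoFibreEquiv(S × V_L) = {η | (η_x 0, η_y 0) ∈ S}`. [folklore] -/
theorem gnoFibreEquiv_image_prod_univ (S : Set (ℝ × ℝ)) :
    gnoFibreEquiv '' (S ×ˢ (univ : Set (GnoFibre L))) = {η : GnoCoord L | (η.1.1 0, η.1.2 0) ∈ S} := by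
  ext η
  constructor
  · rintro ⟨⟨p, y⟩, ⟨hp, -⟩, rfl⟩
    exact hp
  · intro hη
    refine ⟨(gnoFibreEquiv (L := L)).symm η, ⟨?_, mem_univ _⟩, (gnoFibreEquiv (L := L)).apply_symm_apply η⟩
    rw [gnoFibreEquiv_symm_apply]; exact hη

/-- ★ **THE TUBE over a base set**: `gnoFibreEquiv(S × B̄(0,R)) = {η | (η_x 0, η_y 0) ∈ S ∧ ‖gnoFibreOf η‖ ≤ R}`. [folklore] -/
theorem gnoFibreEquiv_image_prod_closedBall (S : Set (ℝ × ℝ)) (R : ℝ) :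
    gnoFibreEquiv '' (S ×ˢ Metric.closedBall (0 : GnoFibre L) R) = {η : GnoCoord L | (η.1.1 0, η.1.2 0) ∈ S ∧ ‖gnoFibreOf η‖ ≤ R} := by
  ext η
  constructor
  · rintro ⟨⟨p, y⟩, ⟨hp, hy⟩, rfl⟩
    refine ⟨hp, ?_⟩
    have e : gnoFibreOf (gnoFibreEquiv (p, y)) = y := congrArg Prod.snd ((gnoFibreEquiv (L := L)).symm_apply_apply (p, y))
    rw [e]; exact mem_closedBall_zero_iff.1 hy
  · rintro ⟨hS, hR⟩
    refine ⟨(gnoFibreEquiv (L := L)).symm η, ⟨?_, ?_⟩, (gnoFibreEquiv (L := L)).apply_symm_apply η⟩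
    · rw [gnoFibreEquiv_symm_apply]; exact hS
    · rw [gnoFibreEquiv_symm_apply]; exact mem_closedBall_zero_iff.2 hR

/-- ★ **IN THE CYLINDER BUT OFF THE TUBE ⟹ a fibre vector of norm `> R`**: every `η ∈ gnoFibreEquiv(S × V_L) ∖ gnoFibreEquiv(S × B̄(0,R))` is `gnoBase x₀ y₀ + gnoFibreEmb y` with
`(x₀,y₀) ∈ S` and `R < ‖y‖` — the form in which w3 g65's ✓`fibre_offTube_floor_gnomonic` (`N(w) ≥ R² ⟹ μ′R² ≤ F̂`) feeds the `hout` of ✓`offTube_bound_of_cylinder`. [folklore] -/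
theorem exists_of_mem_cylinder_not_mem_tube {S : Set (ℝ × ℝ)} {R : ℝ} {η : GnoCoord L}
    (hC : η ∈ gnoFibreEquiv '' (S ×ˢ (univ : Set (GnoFibre L)))) (hT : η ∉ gnoFibreEquiv '' (S ×ˢ Metric.closedBall (0 : GnoFibre L) R)) :
    ∃ p : ℝ × ℝ, p ∈ S ∧ ∃ y : GnoFibre L, R < ‖y‖ ∧ η = gnoBase p.1 p.2 + gnoFibreEmb y := by
  obtain ⟨⟨p, y⟩, ⟨hp, -⟩, rfl⟩ := hC
  refine ⟨p, hp, y, ?_, gnoFibreEquiv_apply p y⟩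
  by_contra hle
  exact hT ⟨(p, y), ⟨hp, mem_closedBall_zero_iff.2 (not_lt.1 hle)⟩, rfl⟩

/-- The cylinder over a measurable base set is measurable. [folklore] -/
theorem measurableSet_cylinder {S : Set (ℝ × ℝ)} (hS : MeasurableSet S) : MeasurableSet (gnoFibreEquiv '' (S ×ˢ (univ : Set (GnoFibre L)))) :=
  (gnoFibreEquiv (L := L)).measurableEmbedding.measurableSet_image.2 (hS.prod MeasurableSet.univ)

/-! ## §3 Volume preservation and the global chart identity -/

/-- The Euclidean fibre read as the letter blocks `W`, as a measurable equivalence (`ofLp`, then three `sumPiEquivProdPi`, then currying the followers). [folklore] -/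
def gnoFibreBlocksEquiv : GnoFibre L ≃ᵐ ((Fin 2 → ℝ) × (Fin 2 → ℝ)) × (Fin 3 → ℝ) × (Fol L → Fin 3 → ℝ) :=
  ((MeasurableEquiv.toLp 2 (GnoFibreIdx L → ℝ)).symm.trans (MeasurableEquiv.sumPiEquivProdPi fun _ : GnoFibreIdx L => ℝ)).trans
    (MeasurableEquiv.prodCongr (MeasurableEquiv.sumPiEquivProdPi fun _ : Fin 2 ⊕ Fin 2 => ℝ)
      ((MeasurableEquiv.sumPiEquivProdPi fun _ : Fin 3 ⊕ Fol L × Fin 3 => ℝ).trans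
        (MeasurableEquiv.prodCongr (MeasurableEquiv.refl (Fin 3 → ℝ)) (MeasurableEquiv.curry (Fol L) (Fin 3) ℝ))))

/-- The block reading preserves volume. [folklore] -/
theorem volume_preserving_gnoFibreBlocksEquiv : MeasurePreserving (gnoFibreBlocksEquiv (L := L)) volume volume := by
  refine ((PiLp.volume_preserving_ofLp (GnoFibreIdx L)).trans (volume_measurePreserving_sumPiEquivProdPi fun _ : GnoFibreIdx L => ℝ)).trans ?_
  refine MeasurePreserving.prod (volume_measurePreserving_sumPiEquivProdPi fun _ : Fin 2 ⊕ Fin 2 => ℝ) ?_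
  refine (volume_measurePreserving_sumPiEquivProdPi fun _ : Fin 3 ⊕ Fol L × Fin 3 => ℝ).trans ?_
  exact MeasurePreserving.prod (MeasurePreserving.id volume) (QuantitativeLaplace.volume_preserving_curry (ι := Fol L) (κ := Fin 3) (X := ℝ))

omit [NeZero L] in
/-- The block reading IS `gnoFibreBlocks`, pointwise (by `rfl`). [folklore] -/
theorem gnoFibreBlocksEquiv_apply (y : GnoFibre L) : gnoFibreBlocksEquiv y = gnoFibreBlocks y := rfl

/-- The shuffle `((a,b),(u,v)) ↦ ((a,u),(b,v))` preserves the product volume (five associator ∕ swap steps). [folklore] -/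
theorem volume_preserving_baseShuffle :
    MeasurePreserving (fun q : (ℝ × ℝ) × ((Fin 2 → ℝ) × (Fin 2 → ℝ)) => ((q.1.1, q.2.1), (q.1.2, q.2.2))) volume volume := by
  have h1 : MeasurePreserving (MeasurableEquiv.prodAssoc : (ℝ × ℝ) × ((Fin 2 → ℝ) × (Fin 2 → ℝ)) ≃ᵐ ℝ × (ℝ × ((Fin 2 → ℝ) × (Fin 2 → ℝ)))) volume volume :=
    volume_preserving_prodAssoc
  have h2 : MeasurePreserving (Prod.map (id : ℝ → ℝ) (MeasurableEquiv.prodAssoc : (ℝ × (Fin 2 → ℝ)) × (Fin 2 → ℝ) ≃ᵐ ℝ × ((Fin 2 → ℝ) × (Fin 2 → ℝ))).symm)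
      (volume : Measure (ℝ × (ℝ × ((Fin 2 → ℝ) × (Fin 2 → ℝ))))) (volume : Measure (ℝ × ((ℝ × (Fin 2 → ℝ)) × (Fin 2 → ℝ)))) :=
    (MeasurePreserving.id volume).prod (volume_preserving_prodAssoc.symm _)
  have h3 : MeasurePreserving (Prod.map (id : ℝ → ℝ) (Prod.map (Prod.swap : ℝ × (Fin 2 → ℝ) → (Fin 2 → ℝ) × ℝ) (id : (Fin 2 → ℝ) → (Fin 2 → ℝ))))
      (volume : Measure (ℝ × ((ℝ × (Fin 2 → ℝ)) × (Fin 2 → ℝ)))) (volume : Measure (ℝ × (((Fin 2 → ℝ) × ℝ) × (Fin 2 → ℝ)))) :=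
    (MeasurePreserving.id volume).prod ((Measure.measurePreserving_swap).prod (MeasurePreserving.id volume))
  have h4 : MeasurePreserving (Prod.map (id : ℝ → ℝ) (MeasurableEquiv.prodAssoc : ((Fin 2 → ℝ) × ℝ) × (Fin 2 → ℝ) ≃ᵐ (Fin 2 → ℝ) × (ℝ × (Fin 2 → ℝ))))
      (volume : Measure (ℝ × (((Fin 2 → ℝ) × ℝ) × (Fin 2 → ℝ)))) (volume : Measure (ℝ × ((Fin 2 → ℝ) × (ℝ × (Fin 2 → ℝ))))) :=
    (MeasurePreserving.id volume).prod volume_preserving_prodAssoc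
  have h5 : MeasurePreserving (MeasurableEquiv.prodAssoc : (ℝ × (Fin 2 → ℝ)) × (ℝ × (Fin 2 → ℝ)) ≃ᵐ ℝ × ((Fin 2 → ℝ) × (ℝ × (Fin 2 → ℝ)))).symm
      (volume : Measure (ℝ × ((Fin 2 → ℝ) × (ℝ × (Fin 2 → ℝ))))) (volume : Measure ((ℝ × (Fin 2 → ℝ)) × (ℝ × (Fin 2 → ℝ)))) :=
    volume_preserving_prodAssoc.symm _
  have h := (((h5.comp h4).comp h3).comp h2).comp h1
  exact h

/-- Inserting the axial coordinates `(a, u) ↦ (a, u₀, u₁)` twice preserves volume (✓`volume_preserving_piFinSuccAbove`). [folklore] -/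
theorem volume_preserving_baseInsert :
    MeasurePreserving (fun q : (ℝ × ℝ) × ((Fin 2 → ℝ) × (Fin 2 → ℝ)) =>
      ((MeasurableEquiv.piFinSuccAbove (fun _ : Fin 3 => ℝ) 0).symm (q.1.1, q.2.1), (MeasurableEquiv.piFinSuccAbove (fun _ : Fin 3 => ℝ) 0).symm (q.1.2, q.2.2)))
      volume volume := by
  have hp : MeasurePreserving (MeasurableEquiv.piFinSuccAbove (fun _ : Fin 3 => ℝ) 0).symm volume volume := (volume_preserving_piFinSuccAbove (fun _ : Fin 3 => ℝ) 0).symm _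
  exact (hp.prod hp).comp volume_preserving_baseShuffle

/-- The chart in block letters `((x₀,y₀), ((u,v),(z,η_F))) ↦ ((x₀∷u, y₀∷v), (z, η_F))` preserves volume. [folklore] -/
theorem volume_preserving_baseBlocks :
    MeasurePreserving (fun q : (ℝ × ℝ) × (((Fin 2 → ℝ) × (Fin 2 → ℝ)) × ((Fin 3 → ℝ) × (Fol L → Fin 3 → ℝ))) =>
      ((((MeasurableEquiv.piFinSuccAbove (fun _ : Fin 3 => ℝ) 0).symm (q.1.1, q.2.1.1), (MeasurableEquiv.piFinSuccAbove (fun _ : Fin 3 => ℝ) 0).symm (q.1.2, q.2.1.2)),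
        q.2.2) : GnoCoord L)) volume volume := by
  have ha : MeasurePreserving (MeasurableEquiv.prodAssoc : ((ℝ × ℝ) × ((Fin 2 → ℝ) × (Fin 2 → ℝ))) × ((Fin 3 → ℝ) × (Fol L → Fin 3 → ℝ)) ≃ᵐ
      (ℝ × ℝ) × (((Fin 2 → ℝ) × (Fin 2 → ℝ)) × ((Fin 3 → ℝ) × (Fol L → Fin 3 → ℝ)))).symm volume volume := volume_preserving_prodAssoc.symm _
  have h := (volume_preserving_baseInsert.prod (MeasurePreserving.id (volume : Measure ((Fin 3 → ℝ) × (Fol L → Fin 3 → ℝ))))).comp ha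
  exact h

omit [NeZero L] in
/-- `0 ∷ u`-type identity: `insertNth 0 a u = ![a, u 0, u 1]`. [folklore] -/
theorem insertNth_zero_fin_two (a : ℝ) (u : Fin 2 → ℝ) : (Fin.insertNth (α := fun _ : Fin 3 => ℝ) 0 a u) = ![a, u 0, u 1] := by
  rw [Fin.insertNth_zero']
  funext k; fin_cases k <;> rfl

/-- ★★ **THE FIBRE∕BASE CHART PRESERVES VOLUME**: `(gnoFibreEquiv)_*(vol_{ℝ×ℝ} ⊗ vol_{V_L}) = vol_{GnoCoord L}`. [folklore] -/
theorem volume_preserving_gnoFibreEquiv : MeasurePreserving (gnoFibreEquiv (L := L)) volume volume := by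
  have hfun : (gnoFibreEquiv (L := L) : (ℝ × ℝ) × GnoFibre L → GnoCoord L) =
      (fun q : (ℝ × ℝ) × (((Fin 2 → ℝ) × (Fin 2 → ℝ)) × ((Fin 3 → ℝ) × (Fol L → Fin 3 → ℝ))) =>
        ((((MeasurableEquiv.piFinSuccAbove (fun _ : Fin 3 => ℝ) 0).symm (q.1.1, q.2.1.1), (MeasurableEquiv.piFinSuccAbove (fun _ : Fin 3 => ℝ) 0).symm (q.1.2, q.2.1.2)),
          q.2.2) : GnoCoord L)) ∘ Prod.map id (gnoFibreBlocksEquiv (L := L)) := by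
    funext q
    obtain ⟨⟨x₀, y₀⟩, y⟩ := q
    rw [gnoFibreEquiv_apply', Function.comp_apply]
    simp only [Prod.map_apply, id_eq, gnoFibreBlocksEquiv_apply, gnoFibreBlocks, MeasurableEquiv.piFinSuccAbove_symm_apply]
    change _ = (((Fin.insertNth (α := fun _ : Fin 3 => ℝ) 0 x₀ (fun j => y (Sum.inl (Sum.inl j))),
      Fin.insertNth (α := fun _ : Fin 3 => ℝ) 0 y₀ (fun j => y (Sum.inl (Sum.inr j)))), _) : GnoCoord L)
    rw [insertNth_zero_fin_two, insertNth_zero_fin_two]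
  rw [hfun]
  exact volume_preserving_baseBlocks.comp ((MeasurePreserving.id volume).prod volume_preserving_gnoFibreBlocksEquiv)

/-- ★ **THE GLOBAL CHART IDENTITY** for a density `ρ` on `GnoCoord L` (e.g. `ρ = ofReal ∘ gnoDensity`):
`vol·ρ = (gnoFibreEquiv)_*((vol_{ℝ×ℝ} ⊗ vol_V)·(ρ ∘ gnoFibreEquiv))` — the `hμ` of ✓`QuantitativeLaplace.restrict_image_eq_map_of_measurableEquiv`. [folklore] -/
theorem volume_withDensity_eq_map_gnoFibreEquiv {ρ : GnoCoord L → ℝ≥0∞} (hρ : Measurable ρ) :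
    (volume : Measure (GnoCoord L)).withDensity ρ =
      (((volume : Measure (ℝ × ℝ)).prod (volume : Measure (GnoFibre L))).withDensity (ρ ∘ gnoFibreEquiv)).map (gnoFibreEquiv (L := L)) := by
  have hv : (volume : Measure (GnoCoord L)) = ((volume : Measure (ℝ × ℝ)).prod (volume : Measure (GnoFibre L))).map (gnoFibreEquiv (L := L)) :=
    (volume_preserving_gnoFibreEquiv (L := L)).map_eq.symm
  rw [hv, Literature.Analysis.Asymptotics.withDensity_map_eq_map_withDensity_comp (gnoFibreEquiv (L := L)).measurable hρ]

/-- ★ **THE CYLINDER CHART IDENTITY**: over a measurable base set `S ⊆ ℝ × ℝ`, the density measure restricted to the cylinder `gnoFibreEquiv(S × V_L)` is the push-forward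
of `((vol|_S) ⊗ vol_V)·(ρ ∘ gnoFibreEquiv)` — the global identity `hμ` for the BULK-CYLINDER measure `μ_C`, base measure `ν = vol|_S` (then
✓`restrict_image_eq_map_of_measurableEquiv` gives the `hchart` of ✓`laplaceMethod_quantitative_fibred_chart_cubic_offBound` on every tube `S' × B̄(0,R)`). [folklore] -/
theorem volume_withDensity_restrict_cylinder_eq_map {ρ : GnoCoord L → ℝ≥0∞} (hρ : Measurable ρ) {S : Set (ℝ × ℝ)} (hS : MeasurableSet S) :
    ((volume : Measure (GnoCoord L)).withDensity ρ).restrict (gnoFibreEquiv '' (S ×ˢ (univ : Set (GnoFibre L)))) =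
      ((((volume : Measure (ℝ × ℝ)).restrict S).prod (volume : Measure (GnoFibre L))).withDensity (ρ ∘ gnoFibreEquiv)).map (gnoFibreEquiv (L := L)) := by
  have hT : MeasurableSet (S ×ˢ (univ : Set (GnoFibre L))) := hS.prod MeasurableSet.univ
  obtain ⟨-, h⟩ := QuantitativeLaplace.restrict_image_eq_map_of_measurableEquiv (κ := (volume : Measure (ℝ × ℝ)).prod (volume : Measure (GnoFibre L)))
    (gnoFibreEquiv (L := L)) (volume_withDensity_eq_map_gnoFibreEquiv hρ) hT
  rw [h, ← Measure.restrict_univ (μ := (volume : Measure (GnoFibre L))), Measure.prod_restrict, Measure.restrict_univ]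

end Summit.QuantumFields.YangMills.Theorems.SwapVirialDeficit.BlowUpRing

end
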